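import Literature.ModelTheory.ExponentialFields.Wilkie1989LocalTransfer
import Literature.ModelTheory.ExponentialFields.Wilkie1989Lemma2
import Literature.ModelTheory.ExponentialFields.Wilkie1989KhovanskiiParams
import Literature.ModelTheory.ExponentialFields.KhovanskiiZeroBound
import Literature.ModelTheory.ExponentialFields.Wilkie1989
import HarnessLib

/-!
# Wilkie 1989, §6: the curve argument of the proof of Theorem 2 (Lemmas 2, 4, 6 and transfer at work)

Trunk `TranscendEllArithS`, family `periods` (periods.S28): the heart of the proof of the leaf
`Literature.ModelTheory.ExponentialFields.Wilkie1989_expAlgebraicPoints_mem` (`Wilkie1989.lean`;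
§6, pp. 405–407 of A. J. Wilkie, *On the theory of the real exponential field*, Illinois J.
Math. 33 (1989), 384–408).

After the preparations of pp. 403–405 (Steps A and B: `Wilkie1989StepsAB.lean`) the inductive step
`P_{j+1,s} ⇒ P_{j+1,s+1}` is in the following situation ("curve form"), in a model `K ⊇ k` of
`T_exp` in which every e.a. point over `k` is bounded over `k`: a subring `M[e^g] = M_T` of
`k[x̄]ᵉ` (`x̄ = x₁, …, x_N`, `N = m + 1 ≥ 2`), curve equations `g₁, …, gₘ ∈ M[e^g]` of degree `≤ s`,
a further function `g_N`, with `det ∂(g₁, …, gₘ)/∂(x₂, …, x_N) ≠ 0` and `g_N* ≠ 0` throughout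
`V = V(g₁, …, gₘ)`, a point `ᾱ ∈ V` with `g_N(ᾱ) = 0`, and the inductive hypothesis `P_{j+1,s}` for
systems of `N` functions of degree `≤ s`.  This file proves that then `ᾱ ∈ kᴺ`
(`RealExpModel.stepC`), following pp. 405–407 literally:

1. the slice `V ∩ ({α₁} × K^m)` is finite (Khovanskii's bound, transferred:
   `Wilkie1989KhovanskiiParams.lean`), so "there certainly exists a `B ∈ k` such that for some
   `r ≥ 1` there are exactly `r` points in `V ∩ ({α₁} × U_B)`, `ᾱ` is one of them, and
   `V ∩ ({α₁} × U_B) = V ∩ ({α₁} × Ū_{B+2})`" (`exists_good_bound`);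
2. Lemma 4, transferred (`CurveTransfer.lemma4Sem_model`), gives `c, d ∈ K`;
3. "`c, d ∈ k`" and "for any `α₁' ∈ k` with `c ≤ α₁' ≤ d` the `r` points of `V ∩ ({α₁'} × Ū_B)`
   all lie in `kᴺ`" (`mem_kPts_of_fst_mem`, `exists_eq_endpoint`): by Lemma 2
   (`RealExpModel.lemma2_cases`) either the inductive hypothesis applies, or the curve equations
   and the pinning functions `x₁ - a` (resp. `xᵢ ∓ γ`) vanish on `Vⁿˢ(h̄)` close to the point, which
   contradicts the local facts transferred in `Wilkie1989LocalTransfer.lean` ((3): uniqueness on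
   the regular curve; two points with equal abscissa or points on both sides);
4. Lemma 6, transferred (`CurveTransfer.lemma6Sem_model`), "interpreted in `K` and … in `k` … gives
   the same answer … Thus all points of `Vⁿˢ(g₁, …, g_N) ∩ ([c, d] × Ū_B)` lie in `kᴺ`. In
   particular `ᾱ ∈ kᴺ`" (`stepC`).

Everything is proved.  Khovanskii's finiteness theorem for square systems is now a theorem of the
tree (`KhovanskiiZeroBound.lean`); it is transferred here (`finite_nonsingularZeroSet'`), so the
primed statements (`finite_slice'`, `exists_good_bound'`, `stepC'`) are unconditional; the
unprimed ones keep the (redundant) hypothesis `Wilkie1989_khovanskiiProposition` for the files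
already importing them.

## References

* A. J. Wilkie, *On the theory of the real exponential field*, Illinois J. Math. 33 (1989),
  384–408: §6, pp. 405–407; Lemma 2 (p. 395); Lemmas 4, 6 (pp. 399–402).
-/

noncomputable section

open FirstOrder FirstOrder.Language FirstOrder.Language.Structure
open Set

namespace Literature.ModelTheory.ExponentialFields

namespace RealExpModel

open CurveTransfer LocalTransfer

variable {k K : Language.Theory.ModelType.{0, 0, 0} realExpTheory}
  {f : k ↪[Language.orderedExpRing] K} {N : ℕ}

/-! ### `k`-points and the two readings of a term of `k[x̄]ᵉ` -/

/-- The set of `k`-rational points of `Kᴺ` (images of `kᴺ` under the embedding). [folklore] -/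
def kPts (f : k ↪[Language.orderedExpRing] K) (N : ℕ) : Set (Fin N → K) :=
  {x | ∃ β : Fin N → k, (f : k → K) ∘ β = x}

/-- **A term with parameters from `k`, read in `k` and in `K`**: `f(t(ȳ)) = t(f(ȳ))`. [folklore] -/
theorem map_realize_id (t : Language.orderedExpRing.Term (k ⊕ Fin N)) (y : Fin N → k) :
    f (t.realize (Sum.elim _root_.id y)) = t.realize (Sum.elim (f : k → K) ((f : k → K) ∘ y)) := by
  rw [← HomClass.realize_term f]
  congr 1
  funext w; rcases w with w | w <;> rfl

/-- Vanishing in `k` and in `K`. [folklore] -/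
theorem realize_id_eq_zero_iff (t : Language.orderedExpRing.Term (k ⊕ Fin N)) (y : Fin N → k) :
    t.realize (Sum.elim _root_.id y) = 0 ↔ t.realize (Sum.elim (f : k → K) ((f : k → K) ∘ y)) = 0 := by
  rw [← map_realize_id, ← map_zero f, f.injective.eq_iff]

/-- Positivity in `k` and in `K`. [folklore] -/
theorem realize_id_pos_iff (t : Language.orderedExpRing.Term (k ⊕ Fin N)) (y : Fin N → k) :
    0 < t.realize (Sum.elim _root_.id y) ↔ 0 < t.realize (Sum.elim (f : k → K) ((f : k → K) ∘ y)) := by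
  rw [← map_realize_id, ← map_zero f, map_lt_iff]

/-- Negativity in `k` and in `K`. [folklore] -/
theorem realize_id_neg_iff (t : Language.orderedExpRing.Term (k ⊕ Fin N)) (y : Fin N → k) :
    t.realize (Sum.elim _root_.id y) < 0 ↔ t.realize (Sum.elim (f : k → K) ((f : k → K) ∘ y)) < 0 := by
  rw [← map_realize_id, ← map_zero f, map_lt_iff]

/-- The representing terms of a system of term functions realize, in `K`, to the functions.
[folklore] -/
theorem realize_reprTerm_eq (F : termFnRing f N) (x : Fin N → K) :
    (reprTerm f N F).realize (Sum.elim (f : k → K) x) = (F : (Fin N → K) → K) x :=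
  realize_reprTerm f N F x

/-- The formal partial derivatives of the representing term realize to Wilkie's `∂F/∂xₗ`.
[folklore] -/
theorem realize_termPDeriv_reprTerm (F : termFnRing f N) (l : Fin N) (x : Fin N → K) :
    (termPDeriv l (reprTerm f N F)).realize (Sum.elim (f : k → K) x) = jrow f N F x l := by
  rw [jrow, coe_pd_of_eq f N l (Subtype.ext (termFn_reprTerm f N F)) x]

variable {m : ℕ}

/-- The curve terms of a system of term functions `g₁, …, gₘ` in `N = m + 1` variables. [folklore] -/
def curveTerms (gc : Fin m → termFnRing f (m + 1)) :
    Fin m → Language.orderedExpRing.Term (k ⊕ Fin (m + 1)) :=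
  fun i => reprTerm f (m + 1) (gc i)

/-- `tailDetT` of the curve terms realizes to `det ∂(g₁, …, gₘ)/∂(x₂, …, x_N)`. [folklore] -/
theorem realize_tailDetT_curveTerms (gc : Fin m → termFnRing f (m + 1)) (x : Fin (m + 1) → K) :
    (tailDetT (curveTerms gc)).realize (Sum.elim (f : k → K) x) =
      (Matrix.of fun i j => jrow f (m + 1) (gc i) x j.succ).det := by
  rw [tailDetT, ExpTerm.realize_det]
  refine congrArg Matrix.det ?_
  ext i j
  simp only [Matrix.map_apply, Matrix.of_apply, curveTerms]
  exact realize_termPDeriv_reprTerm (gc i) j.succ x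

/-- `fullDetT` of the curve terms and `h` realizes to `det ∂(h, g₁, …, gₘ)/∂(x₁, …, x_N)`.
[folklore] -/
theorem realize_fullDetT_curveTerms (gc : Fin m → termFnRing f (m + 1)) (gL : termFnRing f (m + 1))
    (x : Fin (m + 1) → K) :
    (fullDetT (curveTerms gc) (reprTerm f (m + 1) gL)).realize (Sum.elim (f : k → K) x) =
      (Matrix.of (Fin.cons (jrow f (m + 1) gL x) fun i => jrow f (m + 1) (gc i) x)).det := by
  rw [fullDetT, ExpTerm.realize_det]
  refine congrArg Matrix.det ?_
  ext i j
  refine Fin.cases ?_ (fun i => ?_) i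
  · simp only [Matrix.map_apply, Matrix.of_apply, Fin.cons_zero]
    exact realize_termPDeriv_reprTerm gL j x
  · simp only [Matrix.map_apply, Matrix.of_apply, Fin.cons_succ, curveTerms]
    exact realize_termPDeriv_reprTerm (gc i) j x

/-- Membership in the zero set of the curve, in terms of the curve terms. [folklore] -/
theorem realize_curveTerms_eq_zero_iff (gc : Fin m → termFnRing f (m + 1)) (x : Fin (m + 1) → K) :
    (∀ i, (curveTerms gc i).realize (Sum.elim (f : k → K) x) = 0) ↔ x ∈ VF f (m + 1) gc := by
  simp only [curveTerms, realize_reprTerm_eq, mem_VF]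

/-! ### Khovanskii's bound for square systems is a theorem (transfer of `KhovanskiiZeroBound`) -/

/-- **Khovanskii's bound for square systems of terms, in every model of `T_exp`** — now a theorem:
the real bound `RealExpModel.exists_forall_encard_realNonsingularZeroSet_le`
(`KhovanskiiZeroBound.lean`, Khovanskii's theorem proved for `L`-terms) transferred by the
counting formulas of `Wilkie1989Khovanskii.lean` (Wilkie 1989, p. 403: "(and hence at most `N`
points if `p = n`)" … "can be expressed as first-order sentences of `L`"). [cite: Wilkie1989, §5, Proposition, p. 402] -/
theorem exists_encard_nonsingularZeroSet_le_of_real (m n : ℕ)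
    (F : Fin n → Language.orderedExpRing.Term (Fin m ⊕ Fin n)) :
    ∃ N : ℕ, ∀ (K : Language.Theory.ModelType.{0, 0, 0} realExpTheory) (a : Fin m → K),
      (nonsingularZeroSet F a).encard ≤ N := by
  obtain ⟨N, hN⟩ := exists_forall_encard_realNonsingularZeroSet_le F
  refine ⟨N, fun K a => ?_⟩
  have hreal : ∀ v : Fin m → ℝ, (atMostF (vnsFormula F) N).Realize v := fun β => by
    rw [realize_atMostF, setOf_realize_vnsFormula_real]; exact hN β
  have h := realize_formula_of_real K (atMostF (vnsFormula F) N) hreal a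
  rwa [realize_atMostF, setOf_realize_vnsFormula] at h

/-- The same for parameters from an arbitrary type (finitely many occur in the terms:
`RealExpModel.exists_finParams`). [cite: Wilkie1989, §5, p. 403] -/
theorem exists_encard_nonsingularZeroSet_le_any {κ : Type} {n : ℕ}
    (t : Fin n → Language.orderedExpRing.Term (κ ⊕ Fin n)) :
    ∃ N : ℕ, ∀ (K : Language.Theory.ModelType.{0, 0, 0} realExpTheory) (a : κ → K),
      (nonsingularZeroSet t a).encard ≤ N := by
  obtain ⟨m, g, t', ht'⟩ := exists_finParams t
  obtain ⟨N, hN⟩ := exists_encard_nonsingularZeroSet_le_of_real m n t'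
  refine ⟨N, fun K a => ?_⟩
  rw [← nonsingularZeroSet_finParams K (fun a x i => ht' K a x i) a]
  exact hN K (a ∘ g)

/-- **The non-singular zero set of a square system of terms is finite in every model of `T_exp`**
(unconditionally). [cite: Wilkie1989, §5, p. 403] -/
theorem finite_nonsingularZeroSet' {κ : Type} {n : ℕ}
    (t : Fin n → Language.orderedExpRing.Term (κ ⊕ Fin n))
    (K : Language.Theory.ModelType.{0, 0, 0} realExpTheory) (a : κ → K) :
    (nonsingularZeroSet t a).Finite := by
  obtain ⟨N, hN⟩ := exists_encard_nonsingularZeroSet_le_any t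
  exact Set.finite_of_encard_le_coe (hN K a)

/-! ### The slice over `x₁ = α₁` is finite (Khovanskii) -/

/-- Moving the first variable into the parameters: `x̄ = (t, ȳ)` with `t` a parameter. [folklore] -/
def sliceRelabel : k ⊕ Fin (m + 1) → (k ⊕ Fin 1) ⊕ Fin m :=
  Sum.elim (fun c => Sum.inl (Sum.inl c)) (Fin.cases (Sum.inl (Sum.inr 0)) fun j => Sum.inr j)

/-- The slice system: the curve terms with `x₁` frozen to a parameter. [folklore] -/
def sliceTerms (c : Fin m → Language.orderedExpRing.Term (k ⊕ Fin (m + 1))) :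
    Fin m → Language.orderedExpRing.Term ((k ⊕ Fin 1) ⊕ Fin m) :=
  fun i => (c i).relabel sliceRelabel

/-- The assignment of the slice context. [folklore] -/
theorem sliceRelabel_comp (a : k → K) (t : K) (y : Fin m → K) :
    (Sum.elim (Sum.elim a ![t]) y ∘ sliceRelabel : k ⊕ Fin (m + 1) → K) = Sum.elim a (Fin.cons t y) := by
  funext w
  rcases w with c | j
  · rfl
  · refine Fin.cases ?_ (fun j => ?_) j <;> simp [sliceRelabel]

/-- Realization of the slice terms. [folklore] -/
theorem realize_sliceTerms (c : Fin m → Language.orderedExpRing.Term (k ⊕ Fin (m + 1))) (a : k → K)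
    (t : K) (y : Fin m → K) (i : Fin m) :
    (sliceTerms c i).realize (Sum.elim (Sum.elim a ![t]) y) = (c i).realize (Sum.elim a (Fin.cons t y)) := by
  rw [sliceTerms, Term.realize_relabel, sliceRelabel_comp]

/-- Formal partial derivatives of the slice terms: `∂/∂yⱼ` of the slice is `∂/∂xⱼ₊₁` of the
curve term (semantically). [folklore] -/
theorem realize_termPDeriv_sliceTerms {M : Type*} [Language.orderedExpRing.Structure M] [Field M]
    [LinearOrder M] [LawfulStructure M] (c : Language.orderedExpRing.Term (k ⊕ Fin (m + 1)))
    (j : Fin m) (v : (k ⊕ Fin 1) ⊕ Fin m → M) :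
    (termPDeriv j (c.relabel sliceRelabel)).realize v = (termPDeriv j.succ c).realize (v ∘ sliceRelabel) := by
  induction c with
  | var w =>
    rcases w with c | i
    · simp [Term.relabel, termPDeriv, sliceRelabel]
    · refine Fin.cases ?_ (fun i => ?_) i
      · simp [Term.relabel, termPDeriv, sliceRelabel, (Fin.succ_ne_zero j).symm]
      · by_cases hij : i = j
        · subst hij; simp [Term.relabel, termPDeriv, sliceRelabel]
        · have : (Fin.succ i) ≠ Fin.succ j := fun h => hij (Fin.succ_injective _ h)
          simp [Term.relabel, termPDeriv, sliceRelabel, hij, this]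
  | func g ts ih =>
    cases g with
    | add => simp [Term.relabel, termPDeriv, ih]
    | mul => simp [Term.relabel, termPDeriv, ih, Term.realize_relabel]
    | neg => simp [Term.relabel, termPDeriv, ih]
    | zero => simp [Term.relabel, termPDeriv]
    | one => simp [Term.relabel, termPDeriv]
    | exp =>
      simp [Term.relabel, termPDeriv, ih, Term.realize_relabel, ExpTerm.realize_termExp_eq_funMap]

/-- **The slice of the regular curve over `x₁ = t` is finite** ("by the proposition of Section 5 …
there certainly exists a `B ∈ k` such that for some `r` … there are exactly `r` points", p. 406):
its points `ȳ` are exactly the non-singular zeros of the slice system, which are at most `N` by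
Khovanskii's bound (transferred, any parameters). [cite: Wilkie1989, §6, p. 406] -/
theorem finite_slice' (gc : Fin m → termFnRing f (m + 1))
    (htail : ∀ x ∈ VF f (m + 1) gc, (Matrix.of fun i j => jrow f (m + 1) (gc i) x j.succ).det ≠ 0)
    (t : K) : {x : Fin (m + 1) → K | x ∈ VF f (m + 1) gc ∧ x 0 = t}.Finite := by
  set c := curveTerms gc with hc
  have hfin := finite_nonsingularZeroSet' (sliceTerms c) K (Sum.elim (f : k → K) ![t])
  have hsub : {x : Fin (m + 1) → K | x ∈ VF f (m + 1) gc ∧ x 0 = t} ⊆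
      (fun y : Fin m → K => (Fin.cons t y : Fin (m + 1) → K)) ''
        nonsingularZeroSet (sliceTerms c) (Sum.elim (f : k → K) ![t]) := by
    rintro x ⟨hxV, hx0⟩
    refine ⟨Fin.tail x, ⟨fun i => ?_, ?_⟩, by simp only [← hx0]; exact Fin.cons_self_tail x⟩
    · rw [realize_sliceTerms, ← hx0, Fin.cons_self_tail]
      exact (realize_curveTerms_eq_zero_iff gc x).2 hxV i
    · rw [linearIndependent_rows_iff_det_ne_zero]
      have hgrad : (fun i => grad (sliceTerms c i) (Sum.elim (f : k → K) ![t]) (Fin.tail x)) =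
          fun i => (Matrix.of fun i j => jrow f (m + 1) (gc i) x j.succ) i := by
        funext i j
        rw [grad_apply, Matrix.of_apply, sliceTerms, realize_termPDeriv_sliceTerms,
          sliceRelabel_comp, ← hx0, Fin.cons_self_tail]
        exact realize_termPDeriv_reprTerm (gc i) j.succ x
      rw [hgrad]
      exact htail x hxV
  refine (hfin.image _).subset hsub

/-- `finite_slice'` under the (now redundant) hypothesis of Khovanskii's Proposition, kept for the
files already using it. [cite: Wilkie1989, §6, p. 406] -/
theorem finite_slice (_H : Wilkie1989_khovanskiiProposition) (gc : Fin m → termFnRing f (m + 1))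
    (htail : ∀ x ∈ VF f (m + 1) gc, (Matrix.of fun i j => jrow f (m + 1) (gc i) x j.succ).det ≠ 0)
    (t : K) : {x : Fin (m + 1) → K | x ∈ VF f (m + 1) gc ∧ x 0 = t}.Finite :=
  finite_slice' gc htail t

/-! ### The curve form and the inductive hypothesis -/

section Setting

variable (f)

/-- The inductive hypothesis `P_{j+1,s}` at the stage of the induction where the step takes place:
every system of `N` functions of degree `< s + 1` over `M = M_J` in the generator `Y = chainGen J`
has all its non-singular zeros in `kᴺ` (Wilkie 1989, p. 403, `P_{j,s}`). [cite: Wilkie1989, §6, p. 403] -/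
def IH (N : ℕ) (g : ℕ → termFnRing f N) (J s : ℕ) : Prop :=
  ∀ G : Fin N → termFnRing f N, (∀ r, DegLT (chain f N g J) (chainGen f N g J) (G r) (s + 1)) →
    VnsF f N G ⊆ kPts f N

end Setting

/-! ### The bound `B ∈ k` (p. 406) -/

section Bound

variable (f)

/-- The point `ᾱ ∈ V(g₁, …, gₘ)` with `g_N(ᾱ) = 0` and non-vanishing full Jacobian is an
exponential-algebraic point over `k` (witnessed by the representing terms). [folklore] -/
theorem isExpAlgebraicPointOver_of_curve (gc : Fin m → termFnRing f (m + 1)) (gL : termFnRing f (m + 1))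
    {α : Fin (m + 1) → K} (hαV : α ∈ VF f (m + 1) gc) (hαL : ((gL : termFnRing f (m + 1)) : (Fin (m + 1) → K) → K) α = 0)
    (hαfull : (Matrix.of (Fin.cons (jrow f (m + 1) gL α) fun i => jrow f (m + 1) (gc i) α)).det ≠ 0) :
    IsExpAlgebraicPointOver f α := by
  refine ⟨Fin.cons (reprTerm f (m + 1) gL) (curveTerms gc), fun i => ?_, ?_⟩
  · refine Fin.cases ?_ (fun i => ?_) i
    · simpa [realize_reprTerm_eq] using hαL
    · simpa [curveTerms, realize_reprTerm_eq] using (mem_VF.1 hαV) i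
  · have : jacobian (Fin.cons (reprTerm f (m + 1) gL) (curveTerms gc)) f α =
        Matrix.of (Fin.cons (jrow f (m + 1) gL α) fun i => jrow f (m + 1) (gc i) α) := by
      ext i j
      refine Fin.cases ?_ (fun i => ?_) i
      · simp only [jacobian_apply, Fin.cons_zero, Matrix.of_apply, realize_termPDeriv_reprTerm]
      · simp only [jacobian_apply, Fin.cons_succ, Matrix.of_apply, curveTerms,
          realize_termPDeriv_reprTerm]
    rw [this]
    exact hαfull

variable {f}

/-- **"There certainly exists a `B ∈ k` such that …"** (Wilkie 1989, p. 406): by the boundedness of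
the e.a. point `ᾱ` and the finiteness of the slice, there is `B ∈ k`, `B > 0`, with `|αᵢ| < B` for
all `i` and such that every point of `V` over `α₁` has its other coordinates either all of absolute
value `< B` or one of absolute value `> B + 1`. [cite: Wilkie1989, §6, p. 406] -/
theorem exists_good_bound'
    (hbd : ∀ (n : ℕ) (α : Fin n → K), IsExpAlgebraicPointOver f α → IsBoundedOver f α)
    (gc : Fin m → termFnRing f (m + 1)) (gL : termFnRing f (m + 1))
    (htail : ∀ x ∈ VF f (m + 1) gc, (Matrix.of fun i j => jrow f (m + 1) (gc i) x j.succ).det ≠ 0)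
    {α : Fin (m + 1) → K} (hαV : α ∈ VF f (m + 1) gc)
    (hαL : ((gL : termFnRing f (m + 1)) : (Fin (m + 1) → K) → K) α = 0)
    (hαfull : (Matrix.of (Fin.cons (jrow f (m + 1) gL α) fun i => jrow f (m + 1) (gc i) α)).det ≠ 0) :
    ∃ B : k, 0 < f B ∧ (∀ i, |α i| < f B) ∧
      ∀ x ∈ VF f (m + 1) gc, x 0 = α 0 →
        (∀ i : Fin m, |x i.succ| < f B) ∨ ∃ i : Fin m, f B + 1 < |x i.succ| := by
  classical
  -- `ᾱ` is bounded over `k`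
  obtain ⟨a, b, hab⟩ := hbd (m + 1) α (isExpAlgebraicPointOver_of_curve f gc gL hαV hαL hαfull)
  set B₁ : k := max b (-a) with hB₁
  have hαB₁ : ∀ i, |α i| < f B₁ := by
    intro i
    rw [abs_lt]
    constructor
    · have h0 : -a ≤ B₁ := by rw [hB₁]; exact le_max_right _ _
      have h1 : f (-B₁) ≤ f a := (map_le_iff f _ _).2 (neg_le.1 h0)
      rw [RealExpModel.map_neg] at h1
      linarith [(hab i).1]
    · exact lt_of_lt_of_le (hab i).2 ((map_le_iff f _ _).2 (le_max_left _ _))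
  have hB₁pos : 0 < f B₁ := lt_of_le_of_lt (abs_nonneg _) (hαB₁ 0)
  -- the finite slice and bounds for its `k`-bounded coordinates
  have hS := finite_slice' gc htail (α 0)
  have hbnd : ∀ x : Fin (m + 1) → K, ∀ i : Fin m, ∃ c : k, (∃ c' : k, |x i.succ| < f c') → |x i.succ| < f c := by
    intro x i
    by_cases h : ∃ c' : k, |x i.succ| < f c'
    · obtain ⟨c', hc'⟩ := h; exact ⟨c', fun _ => hc'⟩
    · exact ⟨0, fun h' => (h h').elim⟩
  choose bnd hbnd using hbnd
  set B : k := B₁ + 1 + ∑ x ∈ hS.toFinset, ∑ i : Fin m, |bnd x i| with hB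
  have hsum_nonneg : 0 ≤ ∑ x ∈ hS.toFinset, ∑ i : Fin m, |bnd x i| :=
    Finset.sum_nonneg fun x _ => Finset.sum_nonneg fun i _ => abs_nonneg _
  have hB₁B : B₁ ≤ B := by rw [hB]; linarith
  have hbndB : ∀ x ∈ hS.toFinset, ∀ i : Fin m, bnd x i ≤ B := by
    intro x hx i
    have h1 : |bnd x i| ≤ ∑ i : Fin m, |bnd x i| :=
      Finset.single_le_sum (fun i _ => abs_nonneg (bnd x i)) (Finset.mem_univ i)
    have h2 : ∑ i : Fin m, |bnd x i| ≤ ∑ x ∈ hS.toFinset, ∑ i : Fin m, |bnd x i| :=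
      Finset.single_le_sum (fun x _ => Finset.sum_nonneg fun i _ => abs_nonneg (bnd x i)) hx
    have h0 : 0 ≤ B₁ := by
      have := (map_le_iff f 0 B₁).1 (by rw [RealExpModel.map_zero]; exact hB₁pos.le)
      exact this
    rw [hB]
    linarith [le_abs_self (bnd x i)]
  refine ⟨B, lt_of_lt_of_le hB₁pos ((map_le_iff f _ _).2 hB₁B),
    fun i => lt_of_lt_of_le (hαB₁ i) ((map_le_iff f _ _).2 hB₁B), fun x hxV hx0 => ?_⟩
  have hxS : x ∈ hS.toFinset := by rw [Set.Finite.mem_toFinset]; exact ⟨hxV, hx0⟩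
  by_cases hall : ∀ i : Fin m, ∃ c' : k, |x i.succ| < f c'
  · left
    intro i
    exact lt_of_lt_of_le (hbnd x i (hall i)) ((map_le_iff f _ _).2 (hbndB x hxS i))
  · right
    push Not at hall
    obtain ⟨i, hi⟩ := hall
    refine ⟨i, ?_⟩
    have h1 : f (B + 2) ≤ |x i.succ| := hi (B + 2)
    rw [RealExpModel.map_add] at h1
    have h2 : f (2 : k) = (2 : K) := by
      rw [show (2 : k) = 1 + 1 from one_add_one_eq_two.symm, RealExpModel.map_add, RealExpModel.map_one]
      norm_num
    rw [h2] at h1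
    linarith

/-- `exists_good_bound'` under the (now redundant) hypothesis of Khovanskii's Proposition.
[cite: Wilkie1989, §6, p. 406] -/
theorem exists_good_bound (_H : Wilkie1989_khovanskiiProposition)
    (hbd : ∀ (n : ℕ) (α : Fin n → K), IsExpAlgebraicPointOver f α → IsBoundedOver f α)
    (gc : Fin m → termFnRing f (m + 1)) (gL : termFnRing f (m + 1))
    (htail : ∀ x ∈ VF f (m + 1) gc, (Matrix.of fun i j => jrow f (m + 1) (gc i) x j.succ).det ≠ 0)
    {α : Fin (m + 1) → K} (hαV : α ∈ VF f (m + 1) gc)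
    (hαL : ((gL : termFnRing f (m + 1)) : (Fin (m + 1) → K) → K) α = 0)
    (hαfull : (Matrix.of (Fin.cons (jrow f (m + 1) gL α) fun i => jrow f (m + 1) (gc i) α)).det ≠ 0) :
    ∃ B : k, 0 < f B ∧ (∀ i, |α i| < f B) ∧
      ∀ x ∈ VF f (m + 1) gc, x 0 = α 0 →
        (∀ i : Fin m, |x i.succ| < f B) ∨ ∃ i : Fin m, f B + 1 < |x i.succ| :=
  exists_good_bound' hbd gc gL htail hαV hαL hαfull

end Bound

/-! ### The contradiction in cases 1 and 2 of pp. 406–407: no escape from a pinned point -/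

section NoEscape

/-- **The core of Cases 1 and 2** (pp. 406–407).  Let `x̄ ∈ V = V(g₁, …, gₘ)` with
`det ∂(ḡ)/∂(x₂, …)(x̄) ≠ 0`, and let `h₁, …, h_q` (`q < N`) have `x̄` as a non-singular zero, with
every `gᵢ` vanishing on `V(h̄)` close to `x̄`.  If moreover near `x̄` no point of `V(h̄)` has first
coordinate `< x₁` (or: none has first coordinate `> x₁`), we reach a contradiction: by
`pairOrSides` there are either two distinct points of `V(h̄) ⊆ V` close to `x̄` with the same first
coordinate — contradicting the uniqueness (3) on the regular curve `V` — or points of `V(h̄)` close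
to `x̄` on both sides of `x₁`. [cite: Wilkie1989, §6, pp. 406–407] -/
theorem noEscape {q : ℕ} (hq : q < m + 1) {F : Fin q → termFnRing f (m + 1)}
    {x : Fin (m + 1) → K} (hxF : x ∈ VnsF f (m + 1) F) (gc : Fin m → termFnRing f (m + 1))
    (hxV : x ∈ VF f (m + 1) gc)
    (htailx : (Matrix.of fun i j => jrow f (m + 1) (gc i) x j.succ).det ≠ 0)
    (hvc : ∀ i, VCT f (m + 1) (gc i) F x)
    (hside : (∃ ε₁ : K, 0 < ε₁ ∧ ∀ z ∈ VF f (m + 1) F, ∑ j, (z j - x j) ^ 2 < ε₁ → ¬ z 0 < x 0) ∨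
      (∃ ε₁ : K, 0 < ε₁ ∧ ∀ z ∈ VF f (m + 1) F, ∑ j, (z j - x j) ^ 2 < ε₁ → ¬ x 0 < z 0)) :
    False := by
  classical
  -- `gᵢ` vanish on `V(h̄)` near `x`: a common radius
  obtain ⟨εV, hεV, hV⟩ := vct_finset (Finset.univ : Finset (Fin m)) (G := gc) (F := F) (β := x)
    (fun i _ => hvc i)
  have hVmem : ∀ z : Fin (m + 1) → K, ∑ j, (z j - x j) ^ 2 < εV → z ∈ VF f (m + 1) F →
      z ∈ VF f (m + 1) gc := fun z hz hzF => mem_VF.2 fun i => hV i (Finset.mem_univ i) z hz hzF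
  -- uniqueness on the regular curve near `x`
  obtain ⟨εU, hεU, hU⟩ := uniq_model K (curveTerms gc) (f : k → K) x
    ⟨(realize_curveTerms_eq_zero_iff gc x).2 hxV, by rwa [realize_tailDetT_curveTerms]⟩
  -- the side condition
  have hside' : ∃ ε₁ : K, 0 < ε₁ ∧ ((∀ z ∈ VF f (m + 1) F, ∑ j, (z j - x j) ^ 2 < ε₁ → ¬ z 0 < x 0) ∨
      (∀ z ∈ VF f (m + 1) F, ∑ j, (z j - x j) ^ 2 < ε₁ → ¬ x 0 < z 0)) := by
    rcases hside with ⟨ε₁, hε₁, h⟩ | ⟨ε₁, hε₁, h⟩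
    · exact ⟨ε₁, hε₁, Or.inl h⟩
    · exact ⟨ε₁, hε₁, Or.inr h⟩
  obtain ⟨ε₁, hε₁, hS⟩ := hside'
  set ε := min εV (min εU ε₁) with hε
  have hεpos : 0 < ε := lt_min hεV (lt_min hεU hε₁)
  -- the terms of `h̄` and the alternative
  set t : Fin q → Language.orderedExpRing.Term (k ⊕ Fin (m + 1)) := fun r => reprTerm f (m + 1) (F r)
    with htdef
  have ht : ∀ r, fnOf f (m + 1) (t r) = F r := fun r => Subtype.ext (termFn_reprTerm f (m + 1) (F r))
  have hxns : x ∈ nonsingularZeroSet t (f : k → K) := by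
    rw [← VnsF_eq_nonsingularZeroSet ht]; exact hxF
  have hzero : ∀ z, z ∈ zeroSet t (f : k → K) → z ∈ VF f (m + 1) F := fun z hz => by
    rwa [← VF_eq_zeroSet ht] at hz
  rcases pairOrSides_of_mem_nonsingularZeroSet K hq hxns hεpos with
    ⟨z, z', hz, hz', hdz, hdz', hne, h0⟩ | ⟨⟨z, hz, hdz, hlt⟩, ⟨z', hz', hdz', hgt⟩⟩
  · have hzV := hVmem z (lt_of_lt_of_le hdz (min_le_left _ _)) (hzero z hz)
    have hz'V := hVmem z' (lt_of_lt_of_le hdz' (min_le_left _ _)) (hzero z' hz')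
    refine hne (hU z z' ((realize_curveTerms_eq_zero_iff gc z).2 hzV)
      ((realize_curveTerms_eq_zero_iff gc z').2 hz'V) ?_ ?_ h0)
    · exact lt_of_lt_of_le hdz ((min_le_right _ _).trans (min_le_left _ _))
    · exact lt_of_lt_of_le hdz' ((min_le_right _ _).trans (min_le_left _ _))
  · rcases hS with hS | hS
    · exact hS z (hzero z hz) (lt_of_lt_of_le hdz ((min_le_right _ _).trans (min_le_right _ _))) hlt
    · exact hS z' (hzero z' hz') (lt_of_lt_of_le hdz' ((min_le_right _ _).trans (min_le_right _ _))) hgt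

/-- A pinned first coordinate forbids escaping below (and above): if `x₁ - a` vanishes on `V(h̄)`
close to `x̄` then nearby points of `V(h̄)` have first coordinate `x₁`. [folklore] -/
theorem side_of_vct_fst {q : ℕ} {F : Fin q → termFnRing f (m + 1)} {x : Fin (m + 1) → K} {a' : k}
    (hx0 : x 0 = f a')
    (hpin : VCT f (m + 1) (coordFn f (m + 1) 0 - constFn f (m + 1) a') F x) :
    ∃ ε₁ : K, 0 < ε₁ ∧ ∀ z ∈ VF f (m + 1) F, ∑ j, (z j - x j) ^ 2 < ε₁ → ¬ z 0 < x 0 := by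
  obtain ⟨ε₁, hε₁, h⟩ := hpin
  refine ⟨ε₁, hε₁, fun z hzF hz hlt => ?_⟩
  have := h z hz hzF
  simp only [AddSubgroupClass.coe_sub, Pi.sub_apply, coe_coordFn, coe_constFn, sub_eq_zero] at this
  rw [this, hx0] at hlt
  exact lt_irrefl _ hlt

end NoEscape

/-! ### Lemma 2 at a point of `V`: `k`-rational, or no escape (pp. 406–407) -/

section Pins

variable {g : ℕ → termFnRing f (m + 1)}

/-- Elements of given degree over `M_J` lie in `M_{J+1}`. [folklore] -/
theorem DegLT.mem_chain_succ {J : ℕ} {G : termFnRing f (m + 1)} {s : ℕ}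
    (h : DegLT (chain f (m + 1) g J) (chainGen f (m + 1) g J) G s) : G ∈ chain f (m + 1) g (J + 1) := by
  obtain ⟨P, -, rfl⟩ := h
  exact (RealExpModel.mem_chain_succ f (m + 1) g).2 ⟨P, rfl⟩

/-- The pinning function `xₗ - a` lies in every stage `≥ l + 1`. [folklore] -/
theorem coordFn_sub_constFn_mem_chain (l : Fin (m + 1)) (a' : k) {J : ℕ} (hJ : (l : ℕ) + 1 ≤ J) :
    coordFn f (m + 1) l - constFn f (m + 1) a' ∈ chain f (m + 1) g J :=
  Subring.sub_mem _ (chain_mono f (m + 1) g hJ (coordFn_mem_chain f (m + 1) g l))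
    (constFn_mem_chain f (m + 1) g a' J)

/-- **Lemma 2 at a point of the regular curve: `k`-rational or no escape** (the common pattern of
"To see that `d ∈ k` …", "The same argument shows that `c ∈ k` and a similar one shows that for any
`α₁' ∈ k` …", pp. 406–407).  Let `x̄ ∈ V` and let a finite set of *pinning functions* from `M_J`
vanish at `x̄`.  Suppose that whenever `h₁, …, h_q` (`q < N`) have `x̄` as a non-singular zero and the
curve equations and the pinning functions vanish on `V(h̄)` close to `x̄`, no point of `V(h̄)` close
to `x̄` lies below (or: above) `x̄` in the first coordinate.  Then `x̄ ∈ kᴺ`: by Lemma 2, either the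
inductive hypothesis applies (cases (a), and (c) with `hₙ` of degree `≤ s`), or we are in the
situation excluded by `noEscape`. [cite: Wilkie1989, §6, pp. 406–407] -/
theorem mem_kPts_of_pins (hg : ∀ i, m + 1 ≤ i → g i ∈ chain f (m + 1) g i) {J s : ℕ}
    (hIH : IH f (m + 1) g J s) (gc : Fin m → termFnRing f (m + 1))
    (hgc : ∀ i, DegLT (chain f (m + 1) g J) (chainGen f (m + 1) g J) (gc i) (s + 1))
    (htail : ∀ x ∈ VF f (m + 1) gc, (Matrix.of fun i j => jrow f (m + 1) (gc i) x j.succ).det ≠ 0)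
    {x : Fin (m + 1) → K} (hxV : x ∈ VF f (m + 1) gc) (pins : Finset (termFnRing f (m + 1)))
    (hpmem : ∀ u ∈ pins, u ∈ chain f (m + 1) g J)
    (hpzero : ∀ u ∈ pins, ((u : termFnRing f (m + 1)) : (Fin (m + 1) → K) → K) x = 0)
    (hside : ∀ {q : ℕ} (F : Fin q → termFnRing f (m + 1)), q < m + 1 → x ∈ VnsF f (m + 1) F →
      (∀ i, VCT f (m + 1) (gc i) F x) → (∀ u ∈ pins, VCT f (m + 1) u F x) →
        (∃ ε₁ : K, 0 < ε₁ ∧ ∀ z ∈ VF f (m + 1) F, ∑ j, (z j - x j) ^ 2 < ε₁ → ¬ z 0 < x 0) ∨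
          ∃ ε₁ : K, 0 < ε₁ ∧ ∀ z ∈ VF f (m + 1) F, ∑ j, (z j - x j) ^ 2 < ε₁ → ¬ x 0 < z 0) :
    x ∈ kPts f (m + 1) := by
  have hgcmem : ∀ i, gc i ∈ chain f (m + 1) g (J + 1) := fun i => (hgc i).mem_chain_succ
  have hgcx : ∀ i, ((gc i : termFnRing f (m + 1)) : (Fin (m + 1) → K) → K) x = 0 := mem_VF.1 hxV
  have hpmem' : ∀ u ∈ pins, u ∈ chain f (m + 1) g (J + 1) := fun u hu =>
    chain_le_succ f (m + 1) g J (hpmem u hu)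
  obtain ⟨p, F, hpN, hF, hxF, hcases⟩ := lemma2_cases hg J x
  rcases hcases with hpeq | ⟨hplt, h3⟩ | ⟨hplt, G, P, s₀, hmb, hxFG, h3⟩
  · -- (a): the inductive hypothesis applies to `h̄`
    subst hpeq
    exact hIH F (fun r => degLT_of_mem (hF r) (Nat.succ_pos s)) hxF
  · -- (b): clause (3) at stage `J + 1`: no escape
    exfalso
    exact noEscape hplt hxF gc hxV (htail x hxV) (fun i => h3 x rfl hxF (gc i) (hgcmem i) (hgcx i))
      (hside F hplt hxF (fun i => h3 x rfl hxF (gc i) (hgcmem i) (hgcx i))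
        (fun u hu => h3 x rfl hxF u (hpmem' u hu) (hpzero u hu)))
  · by_cases hp1 : p + 1 < m + 1
    · -- (c) with `p + 1 < N`: clause (3) for the extended system: no escape
      exfalso
      exact noEscape hp1 hxFG gc hxV (htail x hxV)
        (fun i => h3 x rfl hxFG (gc i) (hgcmem i) (hgcx i))
        (hside _ hp1 hxFG (fun i => h3 x rfl hxFG (gc i) (hgcmem i) (hgcx i))
          (fun u hu => h3 x rfl hxFG u (hpmem' u hu) (hpzero u hu)))
    · obtain rfl : m = p := by omega
      by_cases hs₀ : s₀ ≤ s
      · -- (c) with `hₙ` of degree `≤ s`: the inductive hypothesis applies to `(h̄, hₙ)`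
        refine hIH (Fin.snoc F G) (fun r => ?_) hxFG
        refine Fin.lastCases ?_ (fun r => ?_) r
        · rw [Fin.snoc_last]
          refine ⟨P, ?_, hmb.hPG⟩
          rw [hmb.hPs]; omega
        · rw [Fin.snoc_castSucc]
          exact degLT_of_mem (hF r) (Nat.succ_pos s)
      · -- (c) with `hₙ` of degree `> s`: everything of degree `≤ s` vanishing at `x` vanishes on
        -- `V(h̄)` close to `x`: no escape
        exfalso
        have hlt : s < s₀ := not_le.1 hs₀
        have hvc : ∀ i, VCT f (m + 1) (gc i) F x := fun i =>
          hmb.hmin (gc i) x (let ⟨Q, hQ, hQe⟩ := hgc i; ⟨Q, by omega, hQe⟩) rfl hmb.hβV (hgcx i)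
        have hpin : ∀ u ∈ pins, VCT f (m + 1) u F x := fun u hu =>
          hmb.hmin u x (degLT_of_mem (hpmem u hu) hmb.hs) rfl hmb.hβV (hpzero u hu)
        exact noEscape (Nat.lt_succ_self m) hxF gc hxV (htail x hxV) hvc
          (hside F (Nat.lt_succ_self m) hxF hvc hpin)

/-- **All points of `V` with `k`-rational first coordinate are `k`-rational** (Wilkie 1989, p. 407:
"a similar one shows that for any `α₁' ∈ k` with `c ≤ α₁' ≤ d`, the `r` points of
`V ∩ ({α₁'} × Ū_B)` all lie in `kⁿ`"; the restriction to `[c, d]` is not needed): pin with `x₁ - α₁'`.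
[cite: Wilkie1989, §6, p. 407] -/
theorem mem_kPts_of_fst_mem (hg : ∀ i, m + 1 ≤ i → g i ∈ chain f (m + 1) g i) {J s : ℕ}
    (hJ : 1 ≤ J) (hIH : IH f (m + 1) g J s) (gc : Fin m → termFnRing f (m + 1))
    (hgc : ∀ i, DegLT (chain f (m + 1) g J) (chainGen f (m + 1) g J) (gc i) (s + 1))
    (htail : ∀ x ∈ VF f (m + 1) gc, (Matrix.of fun i j => jrow f (m + 1) (gc i) x j.succ).det ≠ 0)
    {x : Fin (m + 1) → K} (hxV : x ∈ VF f (m + 1) gc) {a' : k} (hx0 : x 0 = f a') :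
    x ∈ kPts f (m + 1) := by
  classical
  refine mem_kPts_of_pins hg hIH gc hgc htail hxV {coordFn f (m + 1) 0 - constFn f (m + 1) a'}
    (fun u hu => ?_) (fun u hu => ?_) (fun F hq hxF hvc hpin => ?_)
  · rw [Finset.mem_singleton] at hu; subst hu
    exact coordFn_sub_constFn_mem_chain 0 a' (by simp; omega)
  · rw [Finset.mem_singleton] at hu; subst hu
    simp [hx0]
  · exact Or.inl (side_of_vct_fst hx0 (hpin _ (Finset.mem_singleton_self _)))

end Pins

/-! ### The endpoints `c, d` are `k`-rational (pp. 406–407) -/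

section Endpoints

variable {g : ℕ → termFnRing f (m + 1)}

/-- A positive lower bound for finitely many positive elements of an ordered field. [folklore] -/
theorem exists_pos_le_forall_fin {L : Type*} [Field L] [LinearOrder L] [IsStrictOrderedRing L]
    {n : ℕ} (a : Fin n → L) (ha : ∀ j, 0 < a j) : ∃ b : L, 0 < b ∧ ∀ j, b ≤ a j := by
  induction n with
  | zero => exact ⟨1, one_pos, fun j => j.elim0⟩
  | succ n ih =>
    obtain ⟨b, hb, hle⟩ := ih (fun j => a j.succ) (fun j => ha j.succ)
    refine ⟨min b (a 0), lt_min hb (ha 0), fun j => ?_⟩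
    refine Fin.cases ?_ (fun j => ?_) j
    · exact min_le_right _ _
    · exact (min_le_left _ _).trans (hle j)

/-- `(zⱼ - xⱼ)² < ε` for each coordinate when `Σ (zⱼ - xⱼ)² < ε`. [folklore] -/
theorem sq_lt_of_sum_sq_lt {L : Type*} [Field L] [LinearOrder L] [IsStrictOrderedRing L] {n : ℕ}
    {z x : Fin n → L} {ε : L} (h : ∑ j, (z j - x j) ^ 2 < ε) (j : Fin n) : (z j - x j) ^ 2 < ε :=
  lt_of_le_of_lt (Finset.single_le_sum (fun i _ => sq_nonneg (z i - x i)) (Finset.mem_univ j)) h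

/-- **The trap at an endpoint** (the argument "(5) … if `(η₁', …, ηₙ') ∈ Vⁿˢ(h₁, …, hₙ₋₁)` and is
sufficiently close to `η̄` then `η₁' ≥ d`", p. 407): let `η̄ ∈ V` have the event property of Lemma 4
(`|ηᵢ| ≤ γ` for all `i` and `ηᵢ₀ = ±γ` for some `i₀ ≥ 2`, `γ ∈ {B, B + 1}`), and suppose the curve
equations and the pinning functions `xᵢ ∓ γ` (for the coordinates `i ≥ 2` with `ηᵢ = ±γ`) vanish on
`V(h̄)` close to `η̄`.  Then, by the dichotomy of Lemma 4 over `(c, d)` (sup-norm `< B` or `> B + 1`),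
no point of `V(h̄)` close to `η̄` has first coordinate in `(c, d)`. [cite: Wilkie1989, §6, p. 407] -/
theorem trap {q : ℕ} {F : Fin q → termFnRing f (m + 1)} (gc : Fin m → termFnRing f (m + 1))
    {η : Fin (m + 1) → K} {B : k} (hB : 0 < f B) {cc dd : K} (hccB : -f B ≤ cc) (hddB : dd ≤ f B)
    (hiii : ∀ s : K, cc < s → s < dd → ∀ x ∈ VF f (m + 1) gc, x 0 = s →
      (∀ i, |x i| < f B) ∨ ∃ i, f B + 1 < |x i|)
    {b' : k} (hb' : b' = B ∨ b' = B + 1) (hle : ∀ i, |η i| ≤ f b') {j₀ : Fin m}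
    (hj₀ : η j₀.succ = f b' ∨ η j₀.succ = -f b')
    (hvc : ∀ i, VCT f (m + 1) (gc i) F η)
    (hpin : ∀ j : Fin m, (η j.succ = f b' ∨ η j.succ = -f b') →
      ∃ ε₁ : K, 0 < ε₁ ∧ ∀ z ∈ VF f (m + 1) F, ∑ l, (z l - η l) ^ 2 < ε₁ → z j.succ = η j.succ) :
    ∃ ε₂ : K, 0 < ε₂ ∧ ∀ z ∈ VF f (m + 1) F, ∑ l, (z l - η l) ^ 2 < ε₂ → ¬ (cc < z 0 ∧ z 0 < dd) := by
  classical
  have hBb' : f B ≤ f b' := by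
    rcases hb' with rfl | rfl
    · exact le_rfl
    · rw [RealExpModel.map_add, RealExpModel.map_one]; linarith
  have hb'B : f b' ≤ f B + 1 := by
    rcases hb' with rfl | rfl
    · linarith
    · rw [RealExpModel.map_add, RealExpModel.map_one]
  -- the curve equations vanish on `V(h̄)` near `η`
  obtain ⟨εV, hεV, hV⟩ := vct_finset (Finset.univ : Finset (Fin m)) (G := gc) (F := F) (β := η)
    (fun i _ => hvc i)
  -- the pins
  have hpin' : ∀ j : Fin m, ∃ ε₁ : K, 0 < ε₁ ∧ ((η j.succ = f b' ∨ η j.succ = -f b') →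
      ∀ z ∈ VF f (m + 1) F, ∑ l, (z l - η l) ^ 2 < ε₁ → z j.succ = η j.succ) := by
    intro j
    by_cases h : η j.succ = f b' ∨ η j.succ = -f b'
    · obtain ⟨ε₁, hε₁, h1⟩ := hpin j h; exact ⟨ε₁, hε₁, fun _ => h1⟩
    · exact ⟨1, one_pos, fun h' => (h h').elim⟩
  choose εp hεp hp using hpin'
  obtain ⟨εP, hεP, hεPle⟩ := exists_pos_le_forall_fin εp hεp
  -- the slack of the non-pinned coordinates
  have hslack : ∀ j : Fin m, ∃ δ : K, 0 < δ ∧ (¬ (η j.succ = f b' ∨ η j.succ = -f b') →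
      ∀ z : Fin (m + 1) → K, (z j.succ - η j.succ) ^ 2 < δ → |z j.succ| < f B + 1) := by
    intro j
    by_cases h : η j.succ = f b' ∨ η j.succ = -f b'
    · exact ⟨1, one_pos, fun h' => (h' h).elim⟩
    · have hlt : |η j.succ| < f b' := by
        refine lt_of_le_of_ne (hle j.succ) fun heq => h ?_
        rcases abs_eq (le_trans (abs_nonneg _) (hle j.succ)) |>.1 heq with h1 | h1
        · exact Or.inl h1
        · exact Or.inr h1
      refine ⟨(f B + 1 - |η j.succ|) ^ 2, by nlinarith, fun _ z hz => ?_⟩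
      have h1 : |z j.succ - η j.succ| < f B + 1 - |η j.succ| :=
        abs_lt_of_sq_lt_sq hz (by linarith)
      calc |z j.succ| = |η j.succ + (z j.succ - η j.succ)| := by ring_nf
        _ ≤ |η j.succ| + |z j.succ - η j.succ| := abs_add_le _ _
        _ < f B + 1 := by linarith
  choose δs hδs hs using hslack
  obtain ⟨εS, hεS, hεSle⟩ := exists_pos_le_forall_fin δs hδs
  refine ⟨min εV (min εP εS), lt_min hεV (lt_min hεP hεS), fun z hzF hz ⟨hcz, hzd⟩ => ?_⟩
  have hzV : z ∈ VF f (m + 1) gc :=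
    mem_VF.2 fun i => hV i (Finset.mem_univ i) z (lt_of_lt_of_le hz (min_le_left _ _)) hzF
  have hzP : ∀ j : Fin m, (η j.succ = f b' ∨ η j.succ = -f b') → z j.succ = η j.succ := fun j hj =>
    hp j hj z hzF (lt_of_lt_of_le hz ((min_le_right _ _).trans ((min_le_left _ _).trans (hεPle j))))
  have hzj₀ : |z j₀.succ| = f b' := by
    rw [hzP j₀ hj₀]
    rcases hj₀ with h | h <;> rw [h]
    · exact abs_of_pos (lt_of_lt_of_le hB hBb')
    · rw [abs_neg]; exact abs_of_pos (lt_of_lt_of_le hB hBb')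
  rcases hiii (z 0) hcz hzd z hzV rfl with hall | ⟨i, hi⟩
  · have := hall j₀.succ
    rw [hzj₀] at this
    linarith
  · refine Fin.cases ?_ (fun j => ?_) i hi
    · intro h0
      have : |z 0| ≤ f B := abs_le.2 ⟨by linarith, by linarith⟩
      linarith
    · intro hj
      by_cases hpj : η j.succ = f b' ∨ η j.succ = -f b'
      · have hzj : |z j.succ| = f b' := by
          rw [hzP j hpj]
          rcases hpj with h | h <;> rw [h]
          · exact abs_of_pos (lt_of_lt_of_le hB hBb')
          · rw [abs_neg]; exact abs_of_pos (lt_of_lt_of_le hB hBb')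
        rw [hzj] at hj
        linarith
      · have := hs j hpj z (lt_of_lt_of_le (sq_lt_of_sum_sq_lt hz j.succ)
          ((min_le_right _ _).trans ((min_le_right _ _).trans (hεSle j))))
        linarith

/-- **The endpoints are `k`-rational** ("To see that `d ∈ k` …", Wilkie 1989, pp. 406–407; "The
same argument shows that `c ∈ k`", p. 407).  Given the event of Lemma 4 at `e ∈ {c, d}` — a point
`η̄ ∈ V` over `e` of sup-norm exactly `γ ∈ {B, B + 1}` (`⊆ k`) — either `|e| = γ` and `e ∈ k`, or
Lemma 2 at `η̄`, pinned with the functions `xᵢ ∓ γ`, yields `η̄ ∈ kᴺ` (so `e = η₁ ∈ k`) or a contradiction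
(`trap`, `noEscape`). [cite: Wilkie1989, §6, pp. 406–407] -/
theorem exists_eq_endpoint (hg : ∀ i, m + 1 ≤ i → g i ∈ chain f (m + 1) g i) {J s : ℕ}
    (hJ : m + 1 ≤ J) (hIH : IH f (m + 1) g J s) (gc : Fin m → termFnRing f (m + 1))
    (hgc : ∀ i, DegLT (chain f (m + 1) g J) (chainGen f (m + 1) g J) (gc i) (s + 1))
    (htail : ∀ x ∈ VF f (m + 1) gc, (Matrix.of fun i j => jrow f (m + 1) (gc i) x j.succ).det ≠ 0)
    {B : k} (hB : 0 < f B) {cc dd : K} (hcd : cc < dd) (hccB : -f B ≤ cc) (hddB : dd ≤ f B)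
    (hiii : ∀ s : K, cc < s → s < dd → ∀ x ∈ VF f (m + 1) gc, x 0 = s →
      (∀ i, |x i| < f B) ∨ ∃ i, f B + 1 < |x i|)
    {e : K} (he : e = cc ∨ e = dd)
    (hev : ∃ η ∈ VF f (m + 1) gc, η 0 = e ∧ ∃ b' : k, (b' = B ∨ b' = B + 1) ∧
      (∀ i, |η i| ≤ f b') ∧ ∃ i, η i = f b' ∨ η i = -f b') :
    ∃ e' : k, f e' = e := by
  classical
  obtain ⟨η, hηV, hη0, b', hb', hle, i₀, hi₀⟩ := hev
  -- if the first coordinate realizes the norm, we are done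
  by_cases h0 : η 0 = f b' ∨ η 0 = -f b'
  · rcases h0 with h | h
    · exact ⟨b', by rw [← hη0, h]⟩
    · exact ⟨-b', by rw [← hη0, h, RealExpModel.map_neg]⟩
  -- otherwise some later coordinate does; pin those
  have hj₀ : ∃ j₀ : Fin m, η j₀.succ = f b' ∨ η j₀.succ = -f b' := by
    revert hi₀
    refine Fin.cases (fun h => (h0 h).elim) (fun j h => ⟨j, h⟩) i₀
  obtain ⟨j₀, hj₀⟩ := hj₀
  -- the pin values and pinning functions
  have hpinval : ∀ j : Fin m, (η j.succ = f b' ∨ η j.succ = -f b') → ∃ e_j : k, f e_j = η j.succ := by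
    intro j hj
    rcases hj with h | h
    · exact ⟨b', h.symm⟩
    · exact ⟨-b', by rw [RealExpModel.map_neg, h]⟩
  choose! ev hev using hpinval
  set pins : Finset (termFnRing f (m + 1)) :=
    (Finset.univ.filter fun j : Fin m => η j.succ = f b' ∨ η j.succ = -f b').image
      fun j => coordFn f (m + 1) j.succ - constFn f (m + 1) (ev j) with hpins
  have hη : η ∈ kPts f (m + 1) := by
    refine mem_kPts_of_pins hg hIH gc hgc htail hηV pins (fun u hu => ?_) (fun u hu => ?_)
      (fun F hq hηF hvc hpin => ?_)
    · rw [hpins, Finset.mem_image] at hu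
      obtain ⟨j, -, rfl⟩ := hu
      exact coordFn_sub_constFn_mem_chain j.succ (ev j) (by simp; omega)
    · rw [hpins, Finset.mem_image] at hu
      obtain ⟨j, hj, rfl⟩ := hu
      rw [Finset.mem_filter] at hj
      simp [hev j hj.2]
    · -- the trap, from the pins
      have hpin' : ∀ j : Fin m, (η j.succ = f b' ∨ η j.succ = -f b') →
          ∃ ε₁ : K, 0 < ε₁ ∧ ∀ z ∈ VF f (m + 1) F, ∑ l, (z l - η l) ^ 2 < ε₁ → z j.succ = η j.succ := by
        intro j hj
        have hmem : coordFn f (m + 1) j.succ - constFn f (m + 1) (ev j) ∈ pins := by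
          rw [hpins, Finset.mem_image]
          exact ⟨j, Finset.mem_filter.2 ⟨Finset.mem_univ j, hj⟩, rfl⟩
        obtain ⟨ε₁, hε₁, h1⟩ := hpin _ hmem
        refine ⟨ε₁, hε₁, fun z hzF hz => ?_⟩
        have := h1 z hz hzF
        simp only [AddSubgroupClass.coe_sub, Pi.sub_apply, coe_coordFn, coe_constFn, sub_eq_zero] at this
        rw [this, hev j hj]
      obtain ⟨ε₂, hε₂, htrap⟩ := trap gc hB hccB hddB hiii hb' hle hj₀ hvc hpin'
      have hdc : 0 < (dd - cc) ^ 2 := by nlinarith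
      rcases he with he | he
      · -- `e = c`: no point of `V(h̄)` near `η̄` lies above
        refine Or.inr ⟨min ε₂ ((dd - cc) ^ 2), lt_min hε₂ hdc, fun z hzF hz hlt => ?_⟩
        have h1 : |z 0 - η 0| < dd - cc :=
          abs_lt_of_sq_lt_sq (lt_of_lt_of_le (sq_lt_of_sum_sq_lt hz 0) (min_le_right _ _)) (by linarith)
        rw [hη0, he] at h1 hlt
        exact htrap z hzF (lt_of_lt_of_le hz (min_le_left _ _)) ⟨hlt, by linarith [(abs_lt.1 h1).2]⟩
      · -- `e = d`: no point of `V(h̄)` near `η̄` lies below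
        refine Or.inl ⟨min ε₂ ((dd - cc) ^ 2), lt_min hε₂ hdc, fun z hzF hz hlt => ?_⟩
        have h1 : |z 0 - η 0| < dd - cc :=
          abs_lt_of_sq_lt_sq (lt_of_lt_of_le (sq_lt_of_sum_sq_lt hz 0) (min_le_right _ _)) (by linarith)
        rw [hη0, he] at h1 hlt
        exact htrap z hzF (lt_of_lt_of_le hz (min_le_left _ _)) ⟨by linarith [(abs_lt.1 h1).1], hlt⟩
  obtain ⟨β, hβ⟩ := hη
  exact ⟨β 0, by rw [← hη0, ← hβ]; rfl⟩

end Endpoints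

/-! ### Comparing `k` and `K`: the counting argument (p. 407) -/

section Counting

variable {g : ℕ → termFnRing f (m + 1)}

/-- The embedding commutes with `Fin.cons`. [folklore] -/
theorem comp_cons (t : k) (y : Fin m → k) :
    ((f : k → K) ∘ (Fin.cons t y : Fin (m + 1) → k)) = Fin.cons (f t) ((f : k → K) ∘ y) := by
  funext i; refine Fin.cases ?_ (fun i => ?_) i <;> simp

/-- The embedding preserves absolute values. [folklore] -/
theorem map_abs' (a : k) : f |a| = |f a| := by
  rcases le_total 0 a with h | h
  · rw [abs_of_nonneg h, abs_of_nonneg]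
    have := (map_le_iff f 0 a).2 h; rwa [RealExpModel.map_zero] at this
  · rw [abs_of_nonpos h, abs_of_nonpos, RealExpModel.map_neg]
    have := (map_le_iff f a 0).2 h; rwa [RealExpModel.map_zero] at this

/-- `|y| ≤ b` in `k` and in `K`. [folklore] -/
theorem abs_le_iff_map (y b : k) : |y| ≤ b ↔ |f y| ≤ f b := by
  rw [← map_abs', map_le_iff]

/-- `|y| < b` in `k` and in `K`. [folklore] -/
theorem abs_lt_iff_map (y b : k) : |y| < b ↔ |f y| < f b := by
  rw [← map_abs', map_lt_iff]

/-- A `k`-definable set whose `K`-points are `k`-rational is the image of its `k`-points.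
[folklore] -/
theorem image_eq_of_forall_mem_kPts {N' : ℕ} {PK : (Fin N' → K) → Prop} {Pk : (Fin N' → k) → Prop}
    (hiff : ∀ y, Pk y ↔ PK ((f : k → K) ∘ y)) (hk : ∀ x, PK x → x ∈ kPts f N') :
    (fun y : Fin N' → k => (f : k → K) ∘ y) '' {y | Pk y} = {x | PK x} := by
  refine Subset.antisymm ?_ fun x hx => ?_
  · rintro _ ⟨y, hy, rfl⟩; exact (hiff y).1 hy
  · obtain ⟨y, rfl⟩ := hk x hx
    exact ⟨y, (hiff y).2 hx, rfl⟩

/-- Cardinalities of corresponding `k`- and `K`-sets agree. [folklore] -/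
theorem encard_eq_of_forall_mem_kPts {N' : ℕ} {PK : (Fin N' → K) → Prop} {Pk : (Fin N' → k) → Prop}
    (hiff : ∀ y, Pk y ↔ PK ((f : k → K) ∘ y)) (hk : ∀ x, PK x → x ∈ kPts f N') :
    {y | Pk y}.encard = {x | PK x}.encard := by
  have hinj : Function.Injective fun y : Fin N' → k => (f : k → K) ∘ y :=
    fun y y' h => funext fun i => f.injective (congrFun h i)
  rw [← image_eq_of_forall_mem_kPts hiff hk, hinj.encard_image]

end Counting

/-! ### The step in curve form -/

section Step

variable {g : ℕ → termFnRing f (m + 1)}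

/-- **The inductive step of the proof of Theorem 2, in curve form** (Wilkie 1989, pp. 405–407):
given the inductive hypothesis `P_{j+1,s}` (for `N` functions of degree `≤ s` over `M_J`), curve
equations `g₁, …, gₘ` of degree `≤ s` and a function `g_N` with `det ∂(ḡ)/∂(x₂, …, x_N) ≠ 0` and
`det ∂(g_N, ḡ)/∂(x̄) ≠ 0` (i.e. `g_N* ≠ 0`) throughout `V = V(ḡ)`, every point `ᾱ ∈ V` with
`g_N(ᾱ) = 0` is `k`-rational.  ("We are now in a position to apply Lemma 4 (using transfer) …
We thus obtain `c, d ∈ K` … We want to show that `c, d ∈ k` … It now follows … that the hypotheses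
of Lemma 6 are satisfied when interpreted in `K` and when interpreted in `k`. But clearly the
formula given there for the number of zeros of `gₙ` … gives the same answer … Thus all points of
`Vⁿˢ(g₁, …, gₙ) ∩ ([c, d] × Ū_B)` lie in `kⁿ`. In particular `ᾱ ∈ kⁿ`, as required.")
[cite: Wilkie1989, §6, pp. 405–407] -/
theorem stepC'
    (hbd : ∀ (n : ℕ) (α : Fin n → K), IsExpAlgebraicPointOver f α → IsBoundedOver f α)
    (hg : ∀ i, m + 1 ≤ i → g i ∈ chain f (m + 1) g i) {J s : ℕ} (hJ : m + 1 ≤ J)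
    (hIH : IH f (m + 1) g J s) (gc : Fin m → termFnRing f (m + 1))
    (hgc : ∀ i, DegLT (chain f (m + 1) g J) (chainGen f (m + 1) g J) (gc i) (s + 1))
    (gL : termFnRing f (m + 1))
    (htail : ∀ x ∈ VF f (m + 1) gc, (Matrix.of fun i j => jrow f (m + 1) (gc i) x j.succ).det ≠ 0)
    (hfull : ∀ x ∈ VF f (m + 1) gc,
      (Matrix.of (Fin.cons (jrow f (m + 1) gL x) fun i => jrow f (m + 1) (gc i) x)).det ≠ 0)
    {α : Fin (m + 1) → K} (hαV : α ∈ VF f (m + 1) gc)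
    (hαL : ((gL : termFnRing f (m + 1)) : (Fin (m + 1) → K) → K) α = 0) : α ∈ kPts f (m + 1) := by
  classical
  set c := curveTerms gc with hc_def
  set h := reprTerm f (m + 1) gL with hh_def
  -- readings of the terms in `K`
  have hVK : ∀ x : Fin (m + 1) → K, (∀ i, (c i).realize (Sum.elim (f : k → K) x) = 0) ↔
      x ∈ VF f (m + 1) gc := realize_curveTerms_eq_zero_iff gc
  have htailK : ∀ x : Fin (m + 1) → K, (tailDetT c).realize (Sum.elim (f : k → K) x) =
      (Matrix.of fun i j => jrow f (m + 1) (gc i) x j.succ).det := realize_tailDetT_curveTerms gc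
  have hfullK : ∀ x : Fin (m + 1) → K, (fullDetT c h).realize (Sum.elim (f : k → K) x) =
      (Matrix.of (Fin.cons (jrow f (m + 1) gL x) fun i => jrow f (m + 1) (gc i) x)).det :=
    realize_fullDetT_curveTerms gc gL
  have hhK : ∀ x : Fin (m + 1) → K, h.realize (Sum.elim (f : k → K) x) =
      ((gL : termFnRing f (m + 1)) : (Fin (m + 1) → K) → K) x := realize_reprTerm_eq gL
  -- readings in `k`
  have hVk : ∀ y : Fin (m + 1) → k, (∀ i, (c i).realize (Sum.elim _root_.id y) = 0) ↔
      ((f : k → K) ∘ y) ∈ VF f (m + 1) gc := fun y => by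
    rw [← hVK]; exact forall_congr' fun i => realize_id_eq_zero_iff (f := f) (c i) y
  have H1K : ∀ (t : K) (y : Fin m → K), (∀ i, (c i).realize (Sum.elim (f : k → K) (Fin.cons t y)) = 0) →
      ¬ (tailDetT c).realize (Sum.elim (f : k → K) (Fin.cons t y)) = 0 := by
    intro t y hty
    rw [htailK]; exact htail _ ((hVK _).1 hty)
  have H4K : ∀ (t : K) (y : Fin m → K), (∀ i, (c i).realize (Sum.elim (f : k → K) (Fin.cons t y)) = 0) →
      ¬ (fullDetT c h).realize (Sum.elim (f : k → K) (Fin.cons t y)) = 0 := by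
    intro t y hty
    rw [hfullK]; exact hfull _ ((hVK _).1 hty)
  -- Step 1–2: the bound `B`
  obtain ⟨B, hB, hαB, hgood⟩ := exists_good_bound' hbd gc gL htail hαV hαL (hfull α hαV)
  have hfB1 : f (B + 1) = f B + 1 := by rw [RealExpModel.map_add, RealExpModel.map_one]
  -- Step 3: the count `r` over `α₁`
  set S₀ : Set (Fin (m + 1) → K) := {x | ((∀ i, (c i).realize (Sum.elim (f : k → K) x) = 0) ∧
    x 0 = α 0) ∧ ∀ i : Fin m, |x i.succ| < f B} with hS₀
  have hS₀fin : S₀.Finite := by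
    refine (finite_slice' gc htail (α 0)).subset ?_
    rintro x ⟨⟨hx, hx0⟩, -⟩; exact ⟨(hVK x).1 hx, hx0⟩
  set r : ℕ := hS₀fin.toFinset.card with hr_def
  have hS₀card : S₀.encard = r := hS₀fin.encard_eq_coe_toFinset_card
  have hαS₀ : α ∈ S₀ := ⟨⟨(hVK α).2 hαV, rfl⟩, fun i => hαB i.succ⟩
  have hr : 1 ≤ r := by
    have : 0 < S₀.encard := encard_pos.2 ⟨α, hαS₀⟩
    rw [hS₀card] at this
    have h1 : (1 : ℕ∞) ≤ r := Order.one_le_iff_pos.2 this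
    exact_mod_cast h1
  -- Step 4: Lemma 4 in `K`
  have hbox : ∀ (t : K) (y : Fin m → K), (∀ i, (c i).realize (Sum.elim (f : k → K) (Fin.cons t y)) = 0) ∧
      t = α 0 → ((∀ i : Fin m, |y i| < f B) ↔ ∀ i : Fin m, |y i| ≤ f B + 1) := by
    rintro t y ⟨hty, rfl⟩
    have hxV := (hVK _).1 hty
    rcases hgood _ hxV (by simp) with hall | ⟨i, hi⟩
    · simp only [Fin.cons_succ] at hall
      exact ⟨fun _ i => by linarith [hall i], fun _ => hall⟩
    · simp only [Fin.cons_succ] at hi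
      constructor
      · intro hall; linarith [hall i]
      · intro hall; linarith [hall i]
  obtain ⟨cc, dd, ⟨⟨⟨⟨⟨hccB, hcα⟩, hαd, hddB⟩, hcount⟩, hevc⟩, hevd⟩, hiii'⟩ :=
    lemma4Sem_model K c (f : k → K) (f B) (α 0) hr ⟨⟨⟨H1K, hB, hαB 0⟩, hbox⟩, hS₀card⟩
  have hcd : cc < dd := lt_trans hcα hαd
  -- the dichotomy over `(c, d)` in point form
  have hiii : ∀ s : K, cc < s → s < dd → ∀ x ∈ VF f (m + 1) gc, x 0 = s →
      (∀ i, |x i| < f B) ∨ ∃ i, f B + 1 < |x i| := by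
    intro s hcs hsd x hxV hx0
    have := hiii' s ⟨hcs, hsd⟩ (x 0) (Fin.tail x) ⟨by rw [Fin.cons_self_tail]; exact (hVK x).2 hxV, hx0⟩
    simpa only [Fin.cons_self_tail] using this
  -- Step 5: `c, d ∈ k`
  have hev_of : ∀ (e : K), (∃ (t : K) (y : Fin m → K),
      ((∀ i, (c i).realize (Sum.elim (f : k → K) (Fin.cons t y)) = 0) ∧ t = e) ∧
        (((∀ i : Fin (m + 1), |(Fin.cons t y : Fin (m + 1) → K) i| ≤ f B) ∧
            ∃ i : Fin (m + 1), (Fin.cons t y : Fin (m + 1) → K) i = f B ∨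
              (Fin.cons t y : Fin (m + 1) → K) i = -f B) ∨
          (∀ i : Fin (m + 1), |(Fin.cons t y : Fin (m + 1) → K) i| ≤ f B + 1) ∧
            ∃ i : Fin (m + 1), (Fin.cons t y : Fin (m + 1) → K) i = f B + 1 ∨
              (Fin.cons t y : Fin (m + 1) → K) i = -(f B + 1))) →
      ∃ η ∈ VF f (m + 1) gc, η 0 = e ∧ ∃ b' : k, (b' = B ∨ b' = B + 1) ∧
        (∀ i, |η i| ≤ f b') ∧ ∃ i, η i = f b' ∨ η i = -f b' := by
    rintro e ⟨t, y, ⟨hty, rfl⟩, hev⟩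
    refine ⟨Fin.cons t y, (hVK _).1 hty, by simp, ?_⟩
    rcases hev with ⟨hle, i, hi⟩ | ⟨hle, i, hi⟩
    · exact ⟨B, Or.inl rfl, hle, i, hi⟩
    · exact ⟨B + 1, Or.inr rfl, by rw [hfB1]; exact hle, i, by rw [hfB1]; exact hi⟩
  obtain ⟨cc', hcc'⟩ := exists_eq_endpoint hg hJ hIH gc hgc htail hB hcd hccB hddB hiii (Or.inl rfl)
    (hev_of cc hevc)
  obtain ⟨dd', hdd'⟩ := exists_eq_endpoint hg hJ hIH gc hgc htail hB hcd hccB hddB hiii (Or.inr rfl)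
    (hev_of dd hevd)
  -- Claim P in the form needed
  have hClaimP : ∀ x ∈ VF f (m + 1) gc, ∀ a' : k, x 0 = f a' → x ∈ kPts f (m + 1) := fun x hxV a' hx0 =>
    mem_kPts_of_fst_mem hg (by omega) hIH gc hgc htail hxV hx0
  -- Step 6: Lemma 6 in `K`
  have H3K : ∀ t : K, cc < t ∧ t < dd → ∀ (s' : K) (y : Fin m → K),
      (∀ i, (c i).realize (Sum.elim (f : k → K) (Fin.cons s' y)) = 0) ∧ s' = t →
        ((∀ i : Fin m, |y i| < f B) ↔ ∀ i : Fin m, |y i| ≤ f B + 1) := by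
    rintro t ⟨hct, htd⟩ s' y ⟨hsy, rfl⟩
    constructor
    · intro hall i; linarith [hall i]
    · intro hall
      rcases hiii s' hct htd _ ((hVK _).1 hsy) (by simp) with h1 | ⟨i, hi⟩
      · intro i; simpa using h1 i.succ
      · exfalso
        revert hi
        refine Fin.cases ?_ (fun j => ?_) i
        · intro hi
          simp only [Fin.cons_zero] at hi
          have : |s'| ≤ f B := abs_le.2 ⟨by linarith, by linarith⟩
          linarith
        · intro hi
          simp only [Fin.cons_succ] at hi
          linarith [hall j]
  have EK := lemma6Sem_model K c h (f : k → K) (f B) cc dd r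
    ⟨⟨⟨⟨H1K, hB, hcd⟩, hcount⟩, H3K⟩, H4K⟩
  -- Step 6': Lemma 6 in `k`
  have hB' : (0 : k) < B := by
    have := (map_lt_iff f 0 B).1 (by rwa [RealExpModel.map_zero])
    exact this
  have hcd' : cc' < dd' := by rw [← map_lt_iff f, hcc', hdd']; exact hcd
  have H1k : ∀ (t : k) (y : Fin m → k), (∀ i, (c i).realize (Sum.elim _root_.id (Fin.cons t y)) = 0) →
      ¬ (tailDetT c).realize (Sum.elim _root_.id (Fin.cons t y)) = 0 := by
    intro t y hty
    rw [realize_id_eq_zero_iff (f := f), comp_cons]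
    refine H1K (f t) (f ∘ y) ?_
    rw [← comp_cons]; exact ((forall_congr' fun i => (realize_id_eq_zero_iff (f := f) (c i) _)).1 hty)
  have H4k : ∀ (t : k) (y : Fin m → k), (∀ i, (c i).realize (Sum.elim _root_.id (Fin.cons t y)) = 0) →
      ¬ (fullDetT c h).realize (Sum.elim _root_.id (Fin.cons t y)) = 0 := by
    intro t y hty
    rw [realize_id_eq_zero_iff (f := f), comp_cons]
    refine H4K (f t) (f ∘ y) ?_
    rw [← comp_cons]; exact ((forall_congr' fun i => (realize_id_eq_zero_iff (f := f) (c i) _)).1 hty)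
  -- fibre counts in `k`
  have hcountk : ∀ t : k, cc' ≤ t ∧ t ≤ dd' →
      {x : Fin (m + 1) → k | ((∀ i, (c i).realize (Sum.elim _root_.id x) = 0) ∧ x 0 = t) ∧
        ∀ i : Fin m, |x i.succ| ≤ B}.encard = r := by
    rintro t ⟨hct, htd⟩
    have hft : cc ≤ f t ∧ f t ≤ dd := by
      rw [← hcc', ← hdd', map_le_iff, map_le_iff]; exact ⟨hct, htd⟩
    rw [← hcount (f t) hft]
    refine encard_eq_of_forall_mem_kPts (f := f) (fun y => ?_) (fun x hx => ?_)
    · rw [hVk, hVK]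
      simp only [Function.comp_apply, abs_le_iff_map (f := f), f.injective.eq_iff]
    · obtain ⟨⟨hx, hx0⟩, -⟩ := hx
      exact hClaimP x ((hVK x).1 hx) t hx0
  have H3k : ∀ t : k, cc' < t ∧ t < dd' → ∀ (s' : k) (y : Fin m → k),
      (∀ i, (c i).realize (Sum.elim _root_.id (Fin.cons s' y)) = 0) ∧ s' = t →
        ((∀ i : Fin m, |y i| < B) ↔ ∀ i : Fin m, |y i| ≤ B + 1) := by
    rintro t ⟨hct, htd⟩ s' y ⟨hsy, rfl⟩
    have hft : cc < f s' ∧ f s' < dd := by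
      rw [← hcc', ← hdd', map_lt_iff, map_lt_iff]; exact ⟨hct, htd⟩
    have hsyK : ∀ i, (c i).realize (Sum.elim (f : k → K) (Fin.cons (f s') ((f : k → K) ∘ y))) = 0 := by
      rw [← comp_cons]; exact ((forall_congr' fun i => (realize_id_eq_zero_iff (f := f) (c i) _)).1 hsy)
    have := H3K (f s') hft (f s') (f ∘ y) ⟨hsyK, rfl⟩
    simp only [Function.comp_apply, ← abs_lt_iff_map (f := f), ← hfB1, ← abs_le_iff_map (f := f)] at this
    exact this
  have Ek := lemma6Sem_model k c h (_root_.id : k → k) B cc' dd' r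
    ⟨⟨⟨⟨H1k, hB', hcd'⟩, hcountk⟩, H3k⟩, H4k⟩
  -- Step 7: compare the two identities
  -- the sign sets correspond (their points lie over `c` or `d`, hence are `k`-rational)
  have hprodk : ∀ y : Fin (m + 1) → k,
      (fullDetT c h).realize (Sum.elim _root_.id y) * (tailDetT c).realize (Sum.elim _root_.id y) =
        ((fullDetT c h) * (tailDetT c)).realize (Sum.elim _root_.id y) := fun y => by
    rw [ExpTerm.realize_mul]
  have hprodK : ∀ x : Fin (m + 1) → K,
      (fullDetT c h).realize (Sum.elim (f : k → K) x) * (tailDetT c).realize (Sum.elim (f : k → K) x) =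
        ((fullDetT c h) * (tailDetT c)).realize (Sum.elim (f : k → K) x) := fun x => by
    rw [ExpTerm.realize_mul]
  have hsign : ∀ (e' : k) (e : K) (he : f e' = e) (σ τ : Bool),
      {x : Fin (m + 1) → k | ((((∀ i, (c i).realize (Sum.elim _root_.id x) = 0) ∧
          ∀ i : Fin m, |x i.succ| ≤ B) ∧ x 0 = e') ∧
          (if σ then 0 < h.realize (Sum.elim _root_.id x) else h.realize (Sum.elim _root_.id x) < 0)) ∧
          (if τ then 0 < (fullDetT c h).realize (Sum.elim _root_.id x) *
              (tailDetT c).realize (Sum.elim _root_.id x)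
            else (fullDetT c h).realize (Sum.elim _root_.id x) *
              (tailDetT c).realize (Sum.elim _root_.id x) < 0)}.encard =
      {x : Fin (m + 1) → K | ((((∀ i, (c i).realize (Sum.elim (f : k → K) x) = 0) ∧
          ∀ i : Fin m, |x i.succ| ≤ f B) ∧ x 0 = e) ∧
          (if σ then 0 < h.realize (Sum.elim (f : k → K) x) else h.realize (Sum.elim (f : k → K) x) < 0)) ∧
          (if τ then 0 < (fullDetT c h).realize (Sum.elim (f : k → K) x) *
              (tailDetT c).realize (Sum.elim (f : k → K) x)
            else (fullDetT c h).realize (Sum.elim (f : k → K) x) *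
              (tailDetT c).realize (Sum.elim (f : k → K) x) < 0)}.encard := by
    intro e' e he σ τ
    refine encard_eq_of_forall_mem_kPts (f := f) (fun y => ?_) (fun x hx => ?_)
    · rw [hVk, hVK, hprodk, hprodK]
      cases σ <;> cases τ <;>
        simp only [Bool.false_eq_true, ↓reduceIte, Function.comp_apply, abs_le_iff_map (f := f),
          realize_id_pos_iff (f := f), realize_id_neg_iff (f := f), ← he, f.injective.eq_iff]
    · obtain ⟨⟨⟨⟨hx, -⟩, hx0⟩, -⟩, -⟩ := hx
      exact hClaimP x ((hVK x).1 hx) e' (by rw [hx0, he])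
  have hS1 := hsign cc' cc hcc' true true
  have hS2 := hsign cc' cc hcc' false false
  have hS3 := hsign dd' dd hdd' true false
  have hS4 := hsign dd' dd hdd' false true
  simp only [Bool.false_eq_true, ↓reduceIte] at hS1 hS2 hS3 hS4
  -- the zero sets
  set ZK : Set (Fin (m + 1) → K) := {x | ((((∀ i, (c i).realize (Sum.elim (f : k → K) x) = 0) ∧
    ∀ i : Fin m, |x i.succ| ≤ f B) ∧ cc ≤ x 0) ∧ x 0 ≤ dd) ∧ h.realize (Sum.elim (f : k → K) x) = 0}
    with hZK
  set Zk : Set (Fin (m + 1) → k) := {x | ((((∀ i, (c i).realize (Sum.elim _root_.id x) = 0) ∧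
    ∀ i : Fin m, |x i.succ| ≤ B) ∧ cc' ≤ x 0) ∧ x 0 ≤ dd') ∧ h.realize (Sum.elim _root_.id x) = 0}
    with hZk
  have hZiff : ∀ y : Fin (m + 1) → k, y ∈ Zk ↔ ((f : k → K) ∘ y) ∈ ZK := by
    intro y
    simp only [hZk, hZK, Set.mem_setOf_eq, hVK, Function.comp_apply, abs_le_iff_map (f := f),
      realize_id_eq_zero_iff (f := f), ← hcc', ← hdd', map_le_iff]
  have hinj : Function.Injective fun y : Fin (m + 1) → k => (f : k → K) ∘ y :=
    fun y y' hyy => funext fun i => f.injective (congrFun hyy i)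
  have hsub : (fun y : Fin (m + 1) → k => (f : k → K) ∘ y) '' Zk ⊆ ZK := by
    rintro _ ⟨y, hy, rfl⟩; exact (hZiff y).1 hy
  -- the identities, side by side
  change ZK.encard + _ + _ + _ + _ = (r : ℕ∞) at EK
  change Zk.encard + _ + _ + _ + _ = (r : ℕ∞) at Ek
  rw [hS1, hS2, hS3, hS4] at Ek
  set S : ℕ∞ := {x : Fin (m + 1) → K | ((((∀ i, (c i).realize (Sum.elim (f : k → K) x) = 0) ∧
          ∀ i : Fin m, |x i.succ| ≤ f B) ∧ x 0 = cc) ∧ 0 < h.realize (Sum.elim (f : k → K) x)) ∧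
          0 < (fullDetT c h).realize (Sum.elim (f : k → K) x) * (tailDetT c).realize (Sum.elim (f : k → K) x)}.encard +
      {x : Fin (m + 1) → K | ((((∀ i, (c i).realize (Sum.elim (f : k → K) x) = 0) ∧
          ∀ i : Fin m, |x i.succ| ≤ f B) ∧ x 0 = cc) ∧ h.realize (Sum.elim (f : k → K) x) < 0) ∧
          (fullDetT c h).realize (Sum.elim (f : k → K) x) * (tailDetT c).realize (Sum.elim (f : k → K) x) < 0}.encard +
      {x : Fin (m + 1) → K | ((((∀ i, (c i).realize (Sum.elim (f : k → K) x) = 0) ∧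
          ∀ i : Fin m, |x i.succ| ≤ f B) ∧ x 0 = dd) ∧ 0 < h.realize (Sum.elim (f : k → K) x)) ∧
          (fullDetT c h).realize (Sum.elim (f : k → K) x) * (tailDetT c).realize (Sum.elim (f : k → K) x) < 0}.encard +
      {x : Fin (m + 1) → K | ((((∀ i, (c i).realize (Sum.elim (f : k → K) x) = 0) ∧
          ∀ i : Fin m, |x i.succ| ≤ f B) ∧ x 0 = dd) ∧ h.realize (Sum.elim (f : k → K) x) < 0) ∧
          0 < (fullDetT c h).realize (Sum.elim (f : k → K) x) * (tailDetT c).realize (Sum.elim (f : k → K) x)}.encard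
    with hS
  have EK' : ZK.encard + S = r := by rw [hS, ← add_assoc, ← add_assoc, ← add_assoc]; exact EK
  have Ek' : Zk.encard + S = r := by rw [hS, ← add_assoc, ← add_assoc, ← add_assoc]; exact Ek
  have hStop : S ≠ ⊤ := by
    intro htop
    rw [htop, add_top] at EK'
    exact ENat.coe_ne_top r EK'.symm
  have hZeq : ZK.encard = Zk.encard :=
    ENat.add_left_injective_of_ne_top hStop (EK'.trans Ek'.symm)
  have hZKfin : ZK.Finite := by
    refine finite_of_encard_le_coe (k := r) ?_
    rw [← EK']; exact le_self_add
  have himage : (fun y : Fin (m + 1) → k => (f : k → K) ∘ y) '' Zk = ZK :=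
    (hZKfin.subset hsub).eq_of_subset_of_encard_le hsub (by rw [hinj.encard_image, hZeq])
  -- `ᾱ` is a zero in the box
  have hαZ : α ∈ ZK := by
    refine ⟨⟨⟨⟨(hVK α).2 hαV, fun i => (hαB i.succ).le⟩, hcα.le⟩, hαd.le⟩, ?_⟩
    rw [hhK]; exact hαL
  rw [← himage] at hαZ
  obtain ⟨β, -, hβ⟩ := hαZ
  exact ⟨β, hβ⟩

/-- `stepC'` under the (now redundant) hypothesis of Khovanskii's Proposition, kept for the files
already using it. [cite: Wilkie1989, §6, pp. 405–407] -/
theorem stepC (_H : Wilkie1989_khovanskiiProposition)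
    (hbd : ∀ (n : ℕ) (α : Fin n → K), IsExpAlgebraicPointOver f α → IsBoundedOver f α)
    (hg : ∀ i, m + 1 ≤ i → g i ∈ chain f (m + 1) g i) {J s : ℕ} (hJ : m + 1 ≤ J)
    (hIH : IH f (m + 1) g J s) (gc : Fin m → termFnRing f (m + 1))
    (hgc : ∀ i, DegLT (chain f (m + 1) g J) (chainGen f (m + 1) g J) (gc i) (s + 1))
    (gL : termFnRing f (m + 1))
    (htail : ∀ x ∈ VF f (m + 1) gc, (Matrix.of fun i j => jrow f (m + 1) (gc i) x j.succ).det ≠ 0)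
    (hfull : ∀ x ∈ VF f (m + 1) gc,
      (Matrix.of (Fin.cons (jrow f (m + 1) gL x) fun i => jrow f (m + 1) (gc i) x)).det ≠ 0)
    {α : Fin (m + 1) → K} (hαV : α ∈ VF f (m + 1) gc)
    (hαL : ((gL : termFnRing f (m + 1)) : (Fin (m + 1) → K) → K) α = 0) : α ∈ kPts f (m + 1) :=
  stepC' hbd hg hJ hIH gc hgc gL htail hfull hαV hαL

end Step

end RealExpModel

end Literature.ModelTheory.ExponentialFields
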